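import Literature.Analysis.FluidPDE.HardSphereFlowJointMeasurable
import Literature.Analysis.FluidPDE.HardSphereTrajectoryMeasurable
import Literature.Analysis.FluidPDE.FractionalNSPrescribedEnergyIterationLimit
import Literature.MathematicalPhysics.KineticTheory.HardSphereEulerProofs
import HarnessLib

/-!
# Weak readout at the instant `t` (crux `ChaosClosesEuler`, stmt-AtomisticToContinuum-15141, line `Sketch`,
# stub `stub_readout`) — helper 3: measure theory along the flow

WHAT. The measure-theoretic glue of the weak readout.

* `measure_lt_intervalIntegral_flow_le` — TONELLI ALONG A WINDOW + MARKOV: for a law carried by the good set of a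
  hard-sphere flow on `𝕋³` and a nonnegative measurable observable `f` whose expectation along the flow is `≤ e`
  at every instant of the window `(a, b]`, the event `{κ < ∫_a^b f(Φ_u z) du}` has probability
  `≤ (b − a) e / κ` (joint measurability of the flow on its good set, `HardSphereFlow.measurable_flow_prod_torus`).
  This is how the single-time cubic tail input `EnergyCurrentTails` pays the WINDOWED cubic current.
* `integrableOn_integral_of_bdd` / `measurable_sum_kernel_smul` — a bounded time profile `s ↦ ∫ₓ h(s, x) dx`
  that is Fubini-measurable on a compact window is integrable there (cone-mollified fields read along an orbit are
  jointly measurable in `(s, x)` from the measurability of the orbit in time), so that a time-AVERAGED smallness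
  `∫_{[t,t+Δ]} err ≤ ηΔ` yields ONE good instant (`exists_le_of_setIntegral_le`).
* joint continuity / uniform continuity in time / bounds of space–time fields with continuous space–time lift
  (the classical Euler fields).

REFERENCES. C. Cercignani, R. Illner, M. Pulvirenti, *The Mathematical Theory of Dilute Gases* (1994) §4.2,
App. 4.A (measurability of the hard-sphere flow); elementary measure theory otherwise. No named fact is invoked.
-/

noncomputable section

namespace Summit.AtomisticToContinuum.HydrodynamicLimit.Theorems.ChaosClosesEulerReadout

open scoped BigOperators Topology Classical MeasureTheory ENNReal InnerProductSpace
open Filter Set MeasureTheory Function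
open Literature.MathematicalPhysics.KineticTheory
open Literature.Analysis.FluidPDE
open Literature.Analysis.FunctionSpaces

/-! ## §1 Tonelli along a window and Markov -/

section Window

variable {n : ℕ} {ε : ℝ}

/-- **Tonelli along the window + Markov.** For a law `μ` carried by the good set, a nonnegative measurable
observable `f` that is interval integrable along good orbits, and a window `(a, b]`: if
`∫⁻ ofReal (f ∘ Φ_t) dμ ≤ ofReal e` for every `t ∈ (a, b]`, then the event `{κ < ∫_a^b f(Φ_t z) dt}` has probability
at most `(b − a) e / κ` (`κ > 0`, `e ≥ 0`): `∫⁻ ofReal (∫_a^b f(Φ_t z) dt) dμ ≤ ofReal e · (b − a)` by the joint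
measurability of the flow on its good set (`HardSphereFlow.measurable_flow_prod_torus`) and `lintegral_lintegral_swap`,
then Markov. [folklore] -/
theorem measure_lt_intervalIntegral_flow_le (Φ : HardSphereFlow (Torus.geometry (Fin 3)) ε n)
    {μ : Measure (Config n (Fin 3) T3)} [SFinite μ]
    (hμ : μ Φ.goodᶜ = 0) {f : Config n (Fin 3) T3 → ℝ} (hf : Measurable f) (hf0 : ∀ y, 0 ≤ f y)
    (hint : ∀ z ∈ Φ.good, ∀ a b : ℝ, a ≤ b → IntervalIntegrable (fun t => f (Φ.flow t z)) volume a b)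
    {a b : ℝ} (hab : a ≤ b) {e : ℝ} (he : 0 ≤ e)
    (hC : ∀ t ∈ Set.Ioc a b, ∫⁻ z, ENNReal.ofReal (f (Φ.flow t z)) ∂μ ≤ ENNReal.ofReal e) {κ : ℝ} (hκ : 0 < κ) :
    μ {z | κ < ∫ t in a..b, f (Φ.flow t z)} ≤ ENNReal.ofReal ((b - a) * e / κ) := by
  -- Tonelli along the window (adapted from
  -- `OneFlightGossipEngineCollisionActivityTailsNearFieldKineticTails.lintegral_ofReal_intervalIntegral_flow_le`)
  have hT : ∫⁻ z, ENNReal.ofReal (∫ t in a..b, f (Φ.flow t z)) ∂μ ≤ ENNReal.ofReal e * ENNReal.ofReal (b - a) := by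
    -- adapted from `OneFlightGossipEngineCollisionActivityTailsNearFieldKineticTails.lintegral_ofReal_intervalIntegral_flow_le`
    classical
    set S : Set (Config n (Fin 3) T3 × ℝ) := Prod.fst ⁻¹' Φ.good with hS
    have hSm : MeasurableSet S := measurable_fst Φ.measurableSet_good
    set g : S → ENNReal := fun q =>
      ENNReal.ofReal (f (Φ.flow q.1.2 ((⟨q.1.1, q.2⟩ : Φ.good) : Config n (Fin 3) T3))) with hg_def
    have hg : Measurable g := by
      have h1 : Measurable fun q : S => ((⟨q.1.1, q.2⟩ : Φ.good), q.1.2) :=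
        (measurable_subtype_coe.fst.subtype_mk).prodMk measurable_subtype_coe.snd
      exact ENNReal.measurable_ofReal.comp (hf.comp (Φ.measurable_flow_prod_torus.comp h1))
    set F : Config n (Fin 3) T3 × ℝ → ENNReal := fun p => if hp : p ∈ S then g ⟨p, hp⟩ else 0 with hF_def
    have hF : Measurable F := Measurable.dite hg measurable_const hSm
    have hFeq : ∀ p : Config n (Fin 3) T3 × ℝ, p.1 ∈ Φ.good → F p = ENNReal.ofReal (f (Φ.flow p.2 p.1)) := by
      intro p hp
      have hpS : p ∈ S := hp
      simp only [hF_def, dif_pos hpS, hg_def]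
    have hae : ∀ᵐ z ∂μ, z ∈ Φ.good := by
      have h := compl_mem_ae_iff.2 hμ
      rwa [compl_compl] at h
    have h1 : ∀ z ∈ Φ.good,
        ENNReal.ofReal (∫ t in a..b, f (Φ.flow t z)) = ∫⁻ t in Set.Ioc a b, F (z, t) := by
      intro z hz
      rw [intervalIntegral.integral_of_le hab,
        ofReal_integral_eq_lintegral_ofReal (hint z hz a b hab).1 (ae_of_all _ fun t => hf0 _)]
      exact setLIntegral_congr_fun measurableSet_Ioc fun t _ => (hFeq (z, t) hz).symm
    have h2 : ∫⁻ z, (∫⁻ t in Set.Ioc a b, F (z, t)) ∂μ = ∫⁻ t in Set.Ioc a b, (∫⁻ z, F (z, t) ∂μ) :=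
      lintegral_lintegral_swap hF.aemeasurable
    have h3 : ∀ t ∈ Set.Ioc a b, (∫⁻ z, F (z, t) ∂μ) ≤ ENNReal.ofReal e := by
      intro t ht
      calc ∫⁻ z, F (z, t) ∂μ = ∫⁻ z, ENNReal.ofReal (f (Φ.flow t z)) ∂μ :=
            lintegral_congr_ae (by filter_upwards [hae] with z hz using hFeq (z, t) hz)
        _ ≤ ENNReal.ofReal e := hC t ht
    calc ∫⁻ z, ENNReal.ofReal (∫ t in a..b, f (Φ.flow t z)) ∂μ
        = ∫⁻ z, (∫⁻ t in Set.Ioc a b, F (z, t)) ∂μ :=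
          lintegral_congr_ae (by filter_upwards [hae] with z hz using h1 z hz)
      _ = ∫⁻ t in Set.Ioc a b, (∫⁻ z, F (z, t) ∂μ) := h2
      _ ≤ ∫⁻ _ in Set.Ioc a b, ENNReal.ofReal e := setLIntegral_mono' measurableSet_Ioc h3
      _ = ENNReal.ofReal e * ENNReal.ofReal (b - a) := by rw [setLIntegral_const, Real.volume_Ioc]
  have hW : AEMeasurable (fun z => ENNReal.ofReal (∫ t in a..b, f (Φ.flow t z))) μ :=
    (Φ.aemeasurable_intervalIntegral_comp_flow_torus hf a b hμ).ennreal_ofReal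
  have hsub : {z | κ < ∫ t in a..b, f (Φ.flow t z)} ⊆
      {z | ENNReal.ofReal κ ≤ ENNReal.ofReal (∫ t in a..b, f (Φ.flow t z))} :=
    fun z hz => ENNReal.ofReal_le_ofReal (le_of_lt hz)
  have hM := mul_meas_ge_le_lintegral₀ hW (ENNReal.ofReal κ)
  have hκ' : ENNReal.ofReal κ ≠ 0 := by rwa [Ne, ENNReal.ofReal_eq_zero, not_le]
  calc μ {z | κ < ∫ t in a..b, f (Φ.flow t z)}
      ≤ μ {z | ENNReal.ofReal κ ≤ ENNReal.ofReal (∫ t in a..b, f (Φ.flow t z))} := measure_mono hsub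
    _ ≤ (∫⁻ z, ENNReal.ofReal (∫ t in a..b, f (Φ.flow t z)) ∂μ) / ENNReal.ofReal κ := by
        rw [ENNReal.le_div_iff_mul_le (Or.inl hκ') (Or.inl ENNReal.ofReal_ne_top), mul_comm]
        exact hM
    _ ≤ (ENNReal.ofReal e * ENNReal.ofReal (b - a)) / ENNReal.ofReal κ := by gcongr
    _ = ENNReal.ofReal ((b - a) * e / κ) := by
        rw [← ENNReal.ofReal_mul he, ENNReal.ofReal_div_of_pos hκ, mul_comm]

end Window

/-! ## §2 Integrability of pathwise window errors; one good instant -/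

/-- Along a (measurable-in-time) curve of configurations, a cone-type mollified field
`(s, x) ↦ Σᵢ φ(xᵢ(s), x) • c(vᵢ(s))` with jointly continuous kernel `φ` and continuous mark `c` is jointly
measurable in `(s, x)`. [folklore] -/
theorem measurable_sum_kernel_smul {n : ℕ} {γ : ℝ → Config n (Fin 3) T3} (hγ : Measurable γ)
    {E' : Type*} [NormedAddCommGroup E'] [NormedSpace ℝ E'] [MeasurableSpace E'] [BorelSpace E']
    [SecondCountableTopology E'] {φ : T3 → T3 → ℝ} (hφ : Continuous (uncurry φ)) {c : V3 → E'}
    (hc : Continuous c) :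
    Measurable fun p : ℝ × T3 => ∑ i, φ (γ p.1 i).1 p.2 • c (γ p.1 i).2 := by
  refine Finset.measurable_sum _ fun i _ => ?_
  have hi : Measurable fun s : ℝ => γ s i := (measurable_pi_apply i).comp hγ
  have h1 : Measurable fun p : ℝ × T3 => φ (γ p.1 i).1 p.2 :=
    hφ.measurable.comp ((hi.fst.comp measurable_fst).prodMk measurable_snd)
  have h2 : Measurable fun p : ℝ × T3 => c (γ p.1 i).2 := hc.measurable.comp (hi.snd.comp measurable_fst)
  exact h1.smul h2

/-- **Integrability on a window of a bounded, Fubini-measurable time profile.** If `(s, x) ↦ h s x` is a.e.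
strongly measurable for `(volume|[a,b]) ⊗ volume` on `ℝ × 𝕋³` and `‖h s x‖ ≤ C` on `[a, b] × 𝕋³`, then
`s ↦ ∫ₓ h s x dx` is integrable on `[a, b]`. [folklore] -/
theorem integrableOn_integral_of_bdd {E' : Type*} [NormedAddCommGroup E'] [NormedSpace ℝ E'] {h : ℝ → T3 → E'}
    {a b C : ℝ}
    (hm : AEStronglyMeasurable (uncurry h) ((volume.restrict (Set.Icc a b)).prod (volume : Measure T3)))
    (hC : ∀ s ∈ Set.Icc a b, ∀ x, ‖h s x‖ ≤ C) :
    IntegrableOn (fun s => ∫ x, h s x) (Set.Icc a b) volume := by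
  have h1 : AEStronglyMeasurable (fun s => ∫ x, h s x) (volume.restrict (Set.Icc a b)) := hm.integral_prod_right'
  refine ⟨h1, HasFiniteIntegral.of_bounded (C := C * (volume : Measure T3).real Set.univ) ?_⟩
  refine (ae_restrict_iff' measurableSet_Icc).2 (ae_of_all _ fun s hs => ?_)
  exact norm_integral_le_of_norm_le_const (ae_of_all _ fun x => hC s hs x)

/-- **Registered sub-goal `stub_readoutMeasurable` (helper 3 of `stub_readout`): one good instant from a
time-averaged bound.** If `f` is integrable on `[a, b]` (`a < b`) and `∫_{[a,b]} f ≤ c (b − a)` with `c > 0`, then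
`f s ≤ 2c` at some `s ∈ [a, b]`. [folklore] -/
theorem stub_readoutMeasurable : ∀ {f : ℝ → ℝ} {a b c : ℝ}, a < b → MeasureTheory.IntegrableOn f (Set.Icc a b) MeasureTheory.volume → 0 < c → (∫ s in Set.Icc a b, f s) ≤ c * (b - a) → ∃ s ∈ Set.Icc a b, f s ≤ 2 * c := by
  intro f a b c hab hf hc h
  by_contra hcon
  push Not at hcon
  have hconst : IntegrableOn (fun _ : ℝ => 2 * c) (Set.Icc a b) volume :=
    integrableOn_const (by rw [Real.volume_Icc]; exact ENNReal.ofReal_ne_top)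
  have hle : ∫ _ in Set.Icc a b, 2 * c ≤ ∫ s in Set.Icc a b, f s :=
    setIntegral_mono_on hconst hf measurableSet_Icc fun s hs => (hcon s hs).le
  rw [setIntegral_const, measureReal_def, Real.volume_Icc, ENNReal.toReal_ofReal (by linarith), smul_eq_mul] at hle
  nlinarith

/-! ## §3 Space–time fields with continuous space–time lift -/

/-- **Uniform-in-space time continuity on a compact window.** A field jointly continuous on `[a, b] × 𝕋³` is
uniformly continuous there: for `e > 0` there is `d > 0` with `‖u s x − u s' x‖ < e` whenever `s, s' ∈ [a, b]`,
`|s − s'| < d`. [folklore] -/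
theorem exists_time_modulus {F : Type*} [NormedAddCommGroup F] {a b : ℝ} {u : ℝ → T3 → F}
    (hu : ContinuousOn (uncurry u) (Set.Icc a b ×ˢ univ)) {e : ℝ} (he : 0 < e) :
    ∃ d : ℝ, 0 < d ∧ ∀ s ∈ Set.Icc a b, ∀ s' ∈ Set.Icc a b, |s - s'| < d → ∀ x, ‖u s x - u s' x‖ < e := by
  have hK : IsCompact (Set.Icc a b ×ˢ (univ : Set T3)) := isCompact_Icc.prod isCompact_univ
  obtain ⟨d, hd, hU⟩ := Metric.uniformContinuousOn_iff.1 (hK.uniformContinuousOn_of_continuous hu) e he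
  refine ⟨d, hd, fun s hs s' hs' hss' x => ?_⟩
  have h := hU (s, x) (mk_mem_prod hs (mem_univ x)) (s', x) (mk_mem_prod hs' (mem_univ x)) (by
    rw [Prod.dist_eq, dist_self, Real.dist_eq]
    exact max_lt hss' (by simpa using hd))
  rwa [dist_eq_norm] at h

/-- A field jointly continuous on `[a, b] × 𝕋³` is bounded there. [folklore] -/
theorem exists_bound_of_continuousOn_uncurry {F : Type*} [NormedAddCommGroup F] {a b : ℝ} {u : ℝ → T3 → F}
    (hu : ContinuousOn (uncurry u) (Set.Icc a b ×ˢ univ)) :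
    ∃ C : ℝ, 0 ≤ C ∧ ∀ s ∈ Set.Icc a b, ∀ x, ‖u s x‖ ≤ C := by
  have hK : IsCompact (Set.Icc a b ×ˢ (univ : Set T3)) := isCompact_Icc.prod isCompact_univ
  obtain ⟨C, hC⟩ := hK.exists_bound_of_continuousOn hu
  exact ⟨max C 0, le_max_right _ _, fun s hs x => (hC (s, x) (mk_mem_prod hs (mem_univ x))).trans (le_max_left _ _)⟩

/-- A field jointly continuous on `[a, b] × 𝕋³` is a.e. strongly measurable for `(volume|[a,b]) ⊗ volume`.
[folklore] -/
theorem aestronglyMeasurable_uncurry_of_continuousOn {F : Type*} [NormedAddCommGroup F] {a b : ℝ}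
    {u : ℝ → T3 → F} (hu : ContinuousOn (uncurry u) (Set.Icc a b ×ˢ univ)) :
    AEStronglyMeasurable (uncurry u) ((volume.restrict (Set.Icc a b)).prod (volume : Measure T3)) := by
  have h := hu.aestronglyMeasurable (μ := (volume : Measure ℝ).prod (volume : Measure T3))
    (measurableSet_Icc.prod MeasurableSet.univ)
  have hμ : (volume.restrict (Set.Icc a b)).prod (volume : Measure T3) =
      ((volume : Measure ℝ).prod (volume : Measure T3)).restrict (Set.Icc a b ×ˢ univ) := by
    rw [← Measure.prod_restrict, Measure.restrict_univ]
  rw [hμ]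
  exact h

end Summit.AtomisticToContinuum.HydrodynamicLimit.Theorems.ChaosClosesEulerReadout

end
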